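import Mathlib.LinearAlgebra.Quotient.Card
import Mathlib.LinearAlgebra.Isomorphisms
import Mathlib.SetTheory.Cardinal.Finite
import HarnessLib

/-!
# Counting in finite modules: `#ker f = #(M / range f)`, quotients bounded by fibres

Topic `Algebra/Module`; namespace `Literature.Algebra.Module`; theorems only (no named fact, no `sorry`).

Two elementary counting facts for FINITE modules used in the uniform generator bounds of Hida's
control theorem (`#M[p] = #(M/pM)` and "a map whose fibres lie in cosets bounds the number of cosets"):

* **`natCard_ker_eq_natCard_quotient_range`** — for an endomorphism `f` of a finite module,
  `#ker f = #(M / range f)` (`#M = #ker f · #range f = #range f · #(M/range f)`);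
* **`natCard_quotient_le_of_forall_sub_mem`** — if `G : M → β` satisfies
  `G m = G m' ⇒ m − m' ∈ N`, then `#(M/N) ≤ #β` (`β` finite).

[folklore]

## References

* H. Hida, Ann. Inst. Fourier 44 (1994), §3 (held) — where such counts control generators. [Hida1994AIF]
-/

namespace Literature.Algebra.Module

/-- **`#ker f = #(M / range f)` for an endomorphism of a finite module.** [folklore] -/
theorem natCard_ker_eq_natCard_quotient_range {R M : Type*} [Ring R] [AddCommGroup M] [Module R M] [Finite M]
    (f : M →ₗ[R] M) : Nat.card (LinearMap.ker f) = Nat.card (M ⧸ LinearMap.range f) := by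
  have h1 := Submodule.card_eq_card_quotient_mul_card (LinearMap.ker f)
  have h2 := Submodule.card_eq_card_quotient_mul_card (LinearMap.range f)
  have h3 : Nat.card (M ⧸ LinearMap.ker f) = Nat.card (LinearMap.range f) := Nat.card_congr f.quotKerEquivRange.toEquiv
  rw [h3, h2] at h1
  -- `h1 : #range · #(M/range) = #ker · #range`
  rw [mul_comm (Nat.card (LinearMap.ker f))] at h1
  exact (Nat.eq_of_mul_eq_mul_left Nat.card_pos h1).symm

/-- **If the fibres of `G : M → β` lie in cosets of `N`, then `#(M/N) ≤ #β`** (`β` finite). [folklore] -/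
theorem natCard_quotient_le_of_forall_sub_mem {R M : Type*} [Ring R] [AddCommGroup M] [Module R M] {β : Type*} [Finite β]
    (N : Submodule R M) (G : M → β) (hG : ∀ m m', G m = G m' → m - m' ∈ N) : Nat.card (M ⧸ N) ≤ Nat.card β := by
  classical
  let φ : Set.range G → M ⧸ N := fun t => N.mkQ (Classical.choose t.2)
  have hφ : Function.Surjective φ := by
    intro q
    induction q using Submodule.Quotient.induction_on with
    | H m =>
      refine ⟨⟨G m, m, rfl⟩, ?_⟩
      change N.mkQ (Classical.choose (⟨m, rfl⟩ : ∃ m', G m' = G m)) = Submodule.Quotient.mk m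
      rw [Submodule.mkQ_apply, Submodule.Quotient.eq]
      exact hG _ _ (Classical.choose_spec (⟨m, rfl⟩ : ∃ m', G m' = G m))
  exact (Nat.card_le_card_of_surjective φ hφ).trans (Nat.card_le_card_of_injective Subtype.val Subtype.val_injective)

end Literature.Algebra.Module
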